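import Summits.QuantumFields.BalabanUV.T4Continuum.Support.NE7EtaRatesD4CovReg

/-!
# NE7EtaClosenessFromCovRoot — route #1 of the NE7 crux, hardest stub S1∕L7b-background: the CONSUMER-SIDE END — from the COVARIANT
# root of INTERFACE REQUEST NE7→NE3 amendment 3, written out VERBATIM as one hypothesis (T-E_w + (Lip₁ᶜ)(Lip₂′ᶜ)(Lip₂ᶜ) inside the
# ∃(u, Z), the wording the dagwriter typed into WAKE-1), to the four geometric rates at every level past the fit threshold

Cell `pub-balaban`, rung (B)+1 sub-cell t4, lineage `b2b-balaban-t4-ne7-p1`, generation 22 (CRUX PROVER NE7 #1, ruling e34b3e0c); crux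
skeleton `t4/skeletons/NE7-CRUX-R1.md` v1.6.1 §3ter; sequel of `NE7EtaRatesD4Cov` (p252735), `NE7EtaRatesD4CovReg` (p253536).  HONEST
FRAMING (page 1): FIXED FINITE T⁴, rung (B)+1; NE7, NE3 NOT PRINTED in [Balaban1984PropagatorsI]–[Balaban1989LargeFieldII] and NOT PROVED
here; continuum YM on T⁴ ⇐ BetaPertH ∧ nine spine estimates (0/9 proved); BetaPertH ⇐ (D1) ∧ (D4) ∧ CAP+tail; G-an2-4 gates asym, D1 and
NE2/3/4; NOT infinite volume, NOT mass gap, NOT Clay.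

WHAT.  `closeness_of_covRoot`: `d = 4`, `L ≥ 2`, `N ≥ 1`, `θ⁶ = L⁻¹`, class data `0 ≤ b`, `512·5·8·L²·b ≤ 1`, `0 ≤ g`, `0 ≤ C`, the
COVARIANT ROOT as ONE hypothesis `h` (for every `k ≥ 1`, `V ∈ dom`, minimisers `UA` (level `k`), `UB` (level `k+1`, `Regular`):
`∃ u Z`, unitary∕periodic `u`, skew∕periodic `Z`, `gaugeAct u UA = vary W Z 1` (`W = rescale L (bavg L UB)`),
`energyNormW L k W Z (periodBox (N L^k)) ≤ C·residualScale 4 L N b g k`, (Lip₁ᶜ) `Λ₁`, (Lip₂′ᶜ) `Λ₂′`, (Lip₂ᶜ) `Λ₂` — the conjunct order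
of WAKE-1 amendment 3), a budget `γ > 0` with `C·ρ₄ ≤ γ³`, cube roots `l₁, l₂ > 0` with `Λ₁ ≤ l₁³`, `Λ₂ ≤ l₂³`, `Λ₂′ > 0`.  THEN at every
level `k ≥ 1` satisfying the FIT `γ(θ^k)² ≤ min(l₁, l₂)·N`, for every datum and minimiser pair: `∃ u Z` with the representation and
  (P) `‖Z x κ‖ ≤ 8l₁²γ·θ^{8k}`, (Gᶜ) `‖Ad (W (x+e_κ) μ) (Z (x+e_μ) κ) − Z x κ‖ ≤ 4l₁√(2γΛ₂′)·θ^{13k}`,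
  (C) `‖d_W Z (x, π)‖ ≤ 8l₂²γ·θ^{14k}` for every plane, (Q) `‖(gaugeAct u UA)(∂p) − W(∂p)‖ ≤ (8l₂²γ + 1536l₁⁴γ²e^{8l₁²γ})·θ^{14k}` for every
  plaquette.
`closeness_of_covRoot_eventually`: the FIT holds for all `k ≥ k₁` (`NE7EtaRatesD4.exists_fit_threshold`), so the display holds from
`max 1 k₁` on; with `exists_geometric_majorant` this is the binder `hclose`∕`harg` of `T4TowerRateComposition.uRateUpTo_tower` for the
background coordinate of route #1, MODULO NODE O's carrier.  The day row NE3 lands `def NE3EnergyRateWCov` with the WAKE-1 wording,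
`h` is that def unfolded and the by-name consumer is a one-line corollary.
HONEST.  Composition ([folklore]); `h` is a HYPOTHESIS (row NE3's unseated estimate); nothing of NE3∕NE7 discharged; 0 def; 0 sorry.
-/

set_option autoImplicit false

open scoped BigOperators Matrix Matrix.Norms.L2Operator
open Finset

namespace Summit.QuantumFields.BalabanUV.T4Continuum.NE7EtaClosenessFromCovRoot

open Literature.MathematicalPhysics.QuantumFieldTheory.Balaban1983to89
open B7Prop1Explicit B7Prop2Explicit
open T4AveragingDeficitWall hiding Site Plane Plaq Bond
open T4AveragingDeficitWallBoundary (periodBox IsPeriodicCfg)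
open AveragingDeficitPeriodicCounting (IsPeriodicDir)
open MinimalActionSandwich (IsMinimiser)
open MinimalActionRate (Regular)
open NE3EnergyShapes (residualScale IsUnitarySite IsPeriodicSite)
open NE3EnergyWeightedShapes (energyNormW)
open AveragingDeficitDualResidual (dualC1 dualC2)
open AveragingDeficitDerivWallProof (wallConst)
open NE7EtaRatesD4 (energy_budget_of_residualScale exists_fit_threshold)
open NE7EtaRatesD4Cov (norm_dir_le_rate_cov norm_curl_le_rate_cov norm_covDiff_le_rate norm_hol_sub_le_rate_cov)
open NE7EtaRatesD4CovReg (unitary_periodic_rescale_bavg_of_regular)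

noncomputable section

variable {n : Type*} [Fintype n] [DecidableEq n] [Nonempty n]

/-- **THE CONSUMER-SIDE END OF THE BACKGROUND COORDINATE** (module docstring): from the covariant root, written out verbatim as the
hypothesis `h`, to the four rates at every level past the fit. [folklore] -/
theorem closeness_of_covRoot {𝒞 : ℕ → Set (Site 4 → Fin 4 → (Matrix n n ℂ)ˣ)} {L N : ℕ} (hL : 2 ≤ L) (hN : 1 ≤ N) {θ : ℝ}
    (hθ : 0 < θ) (hθ6 : θ ^ 6 = ((L : ℝ))⁻¹) {b g C Λ₁ Λ₂ Λ₂' : ℝ} (hb : 0 ≤ b) (hbs : 512 * (4 + 1) * (4 + 4) * (L : ℝ) ^ 2 * b ≤ 1)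
    (hg : 0 ≤ g) (hC : 0 ≤ C) (hΛ₂' : 0 < Λ₂') {dom : Set (Site 4 → Fin 4 → (Matrix n n ℂ)ˣ)}
    (h : ∀ k : ℕ, 1 ≤ k → ∀ V ∈ dom, ∀ UA UB : Site 4 → Fin 4 → (Matrix n n ℂ)ˣ,
      IsMinimiser 4 𝒞 L N k V UA → IsMinimiser 4 𝒞 L N (k + 1) V UB → Regular 4 L N b g (k + 1) UB →
        ∃ (u : Site 4 → (Matrix n n ℂ)ˣ) (Z : Site 4 → Fin 4 → Matrix n n ℂ),
          IsUnitarySite u ∧ IsPeriodicSite u ((N * L ^ k : ℕ) : ℤ) ∧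
          IsSkewDir Z ∧ IsPeriodicDir Z ((N * L ^ k : ℕ) : ℤ) ∧
          gaugeAct u UA = vary (rescale L (bavg L UB)) Z 1 ∧
          energyNormW L k (rescale L (bavg L UB)) Z (periodBox (N * L ^ k)) ≤ C * residualScale 4 L N b g k ∧
          (∀ (κ : Fin 4) (x : Site 4) (μ : Fin 4),
            ‖Ad (rescale L (bavg L UB) (x + e κ) μ) (Z (x + e μ) κ) - Z x κ‖ ≤ Λ₁ * (((L : ℝ)⁻¹) ^ k) ^ 2) ∧
          (∀ (κ μ : Fin 4) (y : Site 4),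
            ‖Ad (rescale L (bavg L UB) (y + e κ) μ)
                (Ad (rescale L (bavg L UB) (y + e κ + e μ) μ) (Z (y + (2 : ℕ) • e μ) κ) - Z (y + e μ) κ)
              - (Ad (rescale L (bavg L UB) (y + e κ) μ) (Z (y + e μ) κ) - Z y κ)‖ ≤ Λ₂' * (((L : ℝ)⁻¹) ^ k) ^ 3) ∧
          (∀ (π : T4AveragingDeficitWall.Plane 4) (x : Site 4) (ρ : Fin 4),
            ‖Ad (rescale L (bavg L UB) x ρ) (curl (rescale L (bavg L UB)) Z (x + e ρ, π))
              - curl (rescale L (bavg L UB)) Z (x, π)‖ ≤ Λ₂ * (((L : ℝ)⁻¹) ^ k) ^ 3))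
    {γ l₁ l₂ : ℝ} (hγ : 0 < γ)
    (hγ3 : C * (wallConst 4 L * (N : ℝ) ^ 2 * (Real.sqrt g * dualC2 4 L + 2 * b ^ 2 * dualC1 4 L)) ≤ γ ^ 3)
    (hl₁ : 0 < l₁) (hΛl₁ : Λ₁ ≤ l₁ ^ 3) (hl₂ : 0 < l₂) (hΛl₂ : Λ₂ ≤ l₂ ^ 3)
    {k : ℕ} (hk : 1 ≤ k) (hfit₁ : γ * (θ ^ k) ^ 2 ≤ l₁ * N) (hfit₂ : γ * (θ ^ k) ^ 2 ≤ l₂ * N)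
    {V : Site 4 → Fin 4 → (Matrix n n ℂ)ˣ} (hV : V ∈ dom) {UA UB : Site 4 → Fin 4 → (Matrix n n ℂ)ˣ}
    (hA : IsMinimiser 4 𝒞 L N k V UA) (hB : IsMinimiser 4 𝒞 L N (k + 1) V UB) (hreg : Regular 4 L N b g (k + 1) UB) :
    ∃ (u : Site 4 → (Matrix n n ℂ)ˣ) (Z : Site 4 → Fin 4 → Matrix n n ℂ),
      IsUnitarySite u ∧ IsPeriodicSite u ((N * L ^ k : ℕ) : ℤ) ∧ IsSkewDir Z ∧ IsPeriodicDir Z ((N * L ^ k : ℕ) : ℤ) ∧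
      gaugeAct u UA = vary (rescale L (bavg L UB)) Z 1 ∧
      (∀ (x : Site 4) (κ : Fin 4), ‖Z x κ‖ ≤ 8 * l₁ ^ 2 * γ * θ ^ (8 * k)) ∧
      (∀ (x : Site 4) (μ κ : Fin 4),
        ‖Ad (rescale L (bavg L UB) (x + e κ) μ) (Z (x + e μ) κ) - Z x κ‖ ≤ 4 * l₁ * Real.sqrt (2 * γ * Λ₂') * θ ^ (13 * k)) ∧
      (∀ (π : T4AveragingDeficitWall.Plane 4) (x : Site 4),
        ‖curl (rescale L (bavg L UB)) Z (x, π)‖ ≤ 8 * l₂ ^ 2 * γ * θ ^ (14 * k)) ∧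
      (∀ (z : Site 4) (μ ν : Fin 4), μ < ν →
        ‖((hol (gaugeAct u UA) z (plaqWord μ ν) : (Matrix n n ℂ)ˣ) : Matrix n n ℂ)
            - ((hol (rescale L (bavg L UB)) z (plaqWord μ ν) : (Matrix n n ℂ)ˣ) : Matrix n n ℂ)‖
          ≤ (8 * l₂ ^ 2 * γ + 1536 * l₁ ^ 4 * γ ^ 2 * Real.exp (8 * l₁ ^ 2 * γ)) * θ ^ (14 * k)) := by
  obtain ⟨u, Z, hu, huP, hZ, hZP, hrep, hE, h1, h2, h3⟩ := h k hk V hV UA UB hA hB hreg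
  have hL1 : 1 ≤ L := by omega
  obtain ⟨hWu, hWP⟩ := unitary_periodic_rescale_bavg_of_regular hL1 hb hbs hreg
  have hEγ : (L : ℝ) ^ k * energyNormW L k (rescale L (bavg L UB)) Z (periodBox (d := 4) (N * L ^ k)) ≤ γ ^ 3 :=
    (energy_budget_of_residualScale hL1 N b hg hC k hE).trans hγ3
  refine ⟨u, Z, hu, huP, hZ, hZP, hrep, ?_, ?_, ?_, ?_⟩
  · exact fun x κ => norm_dir_le_rate_cov hL hN hk hθ hθ6 hWu hWP hZP hγ hl₁ hΛl₁ hEγ h1 hfit₁ x κ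
  · exact fun x μ κ => norm_covDiff_le_rate hL hN hk hθ hθ6 hWu hWP hZP hγ hl₁ hΛl₁ hΛ₂' hEγ h1 h2 hfit₁ x μ κ
  · exact fun π x => norm_curl_le_rate_cov hL hN hk hθ hθ6 hWu hWP hZP hγ hl₂ hΛl₂ hEγ π (h3 π) hfit₂ x
  · intro z μ ν hμν
    rw [hrep]
    exact norm_hol_sub_le_rate_cov hL hN hk hθ hθ6 hWu hZ hWP hZP hγ hl₁ hΛl₁ hl₂ hΛl₂ hEγ h1 z hμν (h3 ⟨(μ, ν), hμν⟩)
      hfit₁ hfit₂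

/-- **THE FIT IS EVENTUAL** (rider R1-k₁): for `0 < θ < 1`, `γ`, `l₁, l₂ > 0`, `N ≥ 1` there is `k₁` such that both FITs of
`closeness_of_covRoot` hold at every `k ≥ k₁` — so its display holds from `max 1 k₁` on, and `NE7EtaRatesD4.exists_geometric_majorant`
turns any of its four bounds into `≤ C₃θ^{·k}` for ALL `k`. [folklore] -/
theorem fit_eventually {θ : ℝ} (hθ0 : 0 ≤ θ) (hθ1 : θ < 1) (γ : ℝ) {l₁ l₂ : ℝ} (hl₁ : 0 < l₁) (hl₂ : 0 < l₂) {N : ℕ} (hN : 1 ≤ N) :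
    ∃ k₁ : ℕ, ∀ k, k₁ ≤ k → γ * (θ ^ k) ^ 2 ≤ l₁ * N ∧ γ * (θ ^ k) ^ 2 ≤ l₂ * N := by
  have hN0 : (0 : ℝ) < N := by exact_mod_cast (by omega : 0 < N)
  obtain ⟨k₁, hk₁⟩ := exists_fit_threshold hθ0 hθ1 γ (mul_pos hl₁ hN0)
  obtain ⟨k₂, hk₂⟩ := exists_fit_threshold hθ0 hθ1 γ (mul_pos hl₂ hN0)
  exact ⟨max k₁ k₂, fun k hk => ⟨hk₁ k ((le_max_left _ _).trans hk), hk₂ k ((le_max_right _ _).trans hk)⟩⟩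

end

end Summit.QuantumFields.BalabanUV.T4Continuum.NE7EtaClosenessFromCovRoot
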